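import Literature.Analysis.FluidPDE.TaoAveragedImaginaryPower
import Literature.Analysis.FluidPDE.TaoAveragedCascadeAssembly
import Literature.Analysis.FluidPDE.TaoAveragedSlotSobolev
import Mathlib.Analysis.Distribution.SchwartzSpace.Fourier
import Mathlib.Analysis.Fourier.Inversion
import Mathlib.Analysis.SpecialFunctions.ImproperIntegrals
import HarnessLib

/-!
# Tao 2016, §3.3: `B_η` is a complex average of `B` — discharge of `betaForm_isComplexAverage`

T. Tao, *Finite time blowup for an averaged three-dimensional Navier–Stokes equation*,
J. Amer. Math. Soc. **29** (2016), 601–674 = arXiv:1402.0290v3, §3.3 "Third step: forcing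
frequency comparability", p. 16. The named fact
`Literature.Analysis.FluidPDE.Tao2016.betaForm_isComplexAverage` (`TaoAveragedCascadeSteps.lean`):
for `ε₀` below an absolute threshold the frequency-comparable Euler form `B_η` (taken by its
symbol `η(|ξ₁|,|ξ₂|,|ξ₃|) Λ`, `betaForm`) is a complex average (Def. 3.4) of the Euler form `B`.
This file proves it (`betaForm_isComplexAverage_holds`, threshold `ε₁ = 1/5`) along the printed
argument:

1. *"`η(N₁,N₂,N₃) = η(1, e^{log(N₂/N₁)}, e^{log(N₃/N₁)})`, and `(x,y) ↦ η(1,eˣ,eʸ)` is a smooth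
   compactly supported function"*: `η(1,eˣ,eʸ) = F₁(x) F₂(y)` with the profiles
   `Fⱼ(x) = φ((eˣ - |ξⱼ⁰|/|ξ₁⁰|)/(10ε₀²))` (`etaProfile`; smooth, and compactly supported once
   `20ε₀² < |ξⱼ⁰|/|ξ₁⁰|`, `hasCompactSupport_etaProfile`), `eta_eq_etaProfile`.
2. *"By Fourier inversion, we thus have a representation `η(N₁,N₂,N₃) = ∫∫ N₁^{-it₂-it₃} N₂^{it₂} N₃^{it₃} ϕ(t₂,t₃) dt₂dt₃`
   with `ϕ` rapidly decreasing"*: `ϕ = ϕ₁ ⊗ ϕ₂`, `ϕⱼ = 𝓕Fⱼ` Schwartz (`etaPhi`, Mathlib's Fourier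
   transform on `𝓢(ℝ, ℂ)`, variable `t = 2πs`), `∫ e^{2πisx} ϕⱼ(s) ds = Fⱼ(x)`
   (`integral_imagExp_mul_etaPhi`), all moments finite (`integrable_one_add_abs_pow_mul`).
3. *"`B_η := ∫∫ ⟨B(D^{-it₂-it₃}u, D^{it₂}v), D^{it₃}w⟩ ϕ(t₂,t₃) dt₂dt₃` … then `B_η` is a complex
   average of `B` (note that `‖D^{it}‖_k` grows polynomially in `t`)"*: the complex averaging datum
   `betaDatum` on `Ω = ℝ²` with the finite measure `dμ = ((1+s₂²)(1+s₃²))⁻¹ ds` (`betaDatumMeasure`),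
   symbols `m₁ = ϕ₁(s₂)ϕ₂(s₃)(1+s₂²)(1+s₃²) |ξ|^{-2πi(s₂+s₃)}` (the complex weight absorbed into
   `m₁`, §3.2 ¶1), `m₂ = |ξ|^{2πis₂}`, `m₃ = |ξ|^{2πis₃}` (`imagPow`, order `0` with polynomially
   growing seminorms, `TaoAveragedImaginaryPower.lean`), no rotations or dilations; the
   integrability conditions (3.5) follow from the polynomial growth and the decay of `ϕⱼ`
   (`betaMoment_lt_top`).
4. *"From (1.3) and Fubini's theorem … `⟨B_η(u,v), w⟩ = -πi ∫ η(|ξ₁|,|ξ₂|,|ξ₃|) Λ(û(ξ₁), v̂(ξ₂), ŵ(ξ₃))`"*: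
   `\widehat{m(D)u} = m û`, trilinearity of `Λ`, Fubini over `μ × dξ₁dξ₂` (absolute convergence of
   (1.3) on `H¹⁰`, `integrable_Λ_fourierFn`), the phase identity
   `|ξ₁|^{-i(t₂+t₃)}|ξ₂|^{it₂}|ξ₃|^{it₃} = e^{it₂ log(|ξ₂|/|ξ₁|)} e^{it₃ log(|ξ₃|/|ξ₁|)}` and step 2
   (`betaDatum_average_eulerForm`). Tao's footnote "we do not define `η(|ξ₁|,|ξ₂|,|ξ₃|)` when one
   of `ξ₁,ξ₂,ξ₃` vanishes, but this only occurs on a set of measure zero" is the a.e. argument in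
   that proof.

## References

* T. Tao, J. Amer. Math. Soc. 29 (2016), 601–674, arXiv:1402.0290v3, §3.3 p. 16, Def. 3.4,
  (1.3), (1.10), (3.4)–(3.5). Key `Tao2016AveragedNS`.
-/

noncomputable section

open Set Filter MeasureTheory FourierTransform
open scoped ENNReal NNReal Topology SchwartzMap FourierTransform

namespace Literature.Analysis.FluidPDE.Tao2016

/-- Local notation for physical / frequency space `ℝ³`. -/
local notation "ℝ³" => EuclideanSpace ℝ (Fin 3)
/-- Local notation for the complexified range `ℂ³`. -/
local notation "ℂ³" => EuclideanSpace ℂ (Fin 3)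

/-! ### Step 1: `η(1, eˣ, eʸ) = F₁(x) F₂(y)` with smooth compactly supported profiles -/

/-- The **logarithmic profiles** of the comparability weight:
`Fⱼ(x) = φ((eˣ - |ξⱼ⁰|/|ξ₁⁰|)/(10ε₀²))`, so that `η(N₁,N₂,N₃) = F₁(log(N₂/N₁)) F₂(log(N₃/N₁))`
("`η(N₁,N₂,N₃) = η(1,e^{log(N₂/N₁)},e^{log(N₃/N₁)})`", Tao p. 16). [cite: Tao2016AveragedNS, §3.3 p. 16] -/
def etaProfile (ε₀ : ℝ) (j : Fin 3) (x : ℝ) : ℝ :=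
  freqCutoff ((Real.exp x - ‖xi0 j‖ / ‖xi0 0‖) / (10 * ε₀ ^ 2))

/-- **`η(N₁,N₂,N₃) = F₁(log N₂ - log N₁) F₂(log N₃ - log N₁)`** for positive `Nᵢ`. [cite: Tao2016AveragedNS, §3.3 p. 16] -/
theorem eta_eq_etaProfile (ε₀ : ℝ) {N₁ N₂ N₃ : ℝ} (h₁ : 0 < N₁) (h₂ : 0 < N₂) (h₃ : 0 < N₃) :
    eta ε₀ N₁ N₂ N₃ =
      etaProfile ε₀ 1 (Real.log N₂ - Real.log N₁) * etaProfile ε₀ 2 (Real.log N₃ - Real.log N₁) := by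
  unfold eta etaProfile
  rw [Real.exp_sub, Real.exp_log h₂, Real.exp_log h₁, Real.exp_sub, Real.exp_log h₃, Real.exp_log h₁]

/-- The profiles are smooth. [folklore] -/
theorem contDiff_etaProfile (ε₀ : ℝ) (j : Fin 3) {n : ℕ∞} : ContDiff ℝ n (etaProfile ε₀ j) :=
  contDiff_freqCutoff.comp ((Real.contDiff_exp.sub contDiff_const).div_const _)

/-- The profiles are continuous. [folklore] -/
theorem continuous_etaProfile (ε₀ : ℝ) (j : Fin 3) : Continuous (etaProfile ε₀ j) :=
  (contDiff_etaProfile ε₀ j (n := 0)).continuous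

/-- The ratios `|ξⱼ⁰|/|ξ₁⁰|` are at least `1` (`|ξ₁⁰| = |ξ₃⁰| = 1`, `|ξ₂⁰| = √2`). [cite: Tao2016AveragedNS, (3.7)] -/
theorem one_le_norm_xi0_div (j : Fin 3) : 1 ≤ ‖xi0 j‖ / ‖xi0 0‖ := by
  rw [norm_xi0_zero, div_one]
  fin_cases j
  · simp [norm_xi0_zero]
  · simp only [Fin.mk_one, norm_xi0_one]
    exact Real.one_le_sqrt.2 (by norm_num)
  · simp [norm_xi0_two]

/-- **The profiles are compactly supported** when `20ε₀² < 1 ≤ |ξⱼ⁰|/|ξ₁⁰|` (e.g. `0 < ε₀ ≤ 1/5`):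
`Fⱼ` vanishes off `[log(rⱼ - 20ε₀²), log(rⱼ + 20ε₀²)]`, `rⱼ = |ξⱼ⁰|/|ξ₁⁰|` ("`(x,y) ↦ η(1,eˣ,eʸ)` is a
smooth compactly supported function", Tao p. 16). [cite: Tao2016AveragedNS, §3.3 p. 16] -/
theorem hasCompactSupport_etaProfile {ε₀ : ℝ} (hε : 0 < ε₀) (hε' : ε₀ ≤ 1 / 5) (j : Fin 3) :
    HasCompactSupport (etaProfile ε₀ j) := by
  set r : ℝ := ‖xi0 j‖ / ‖xi0 0‖ with hr
  have hδ : 0 < 10 * ε₀ ^ 2 := by positivity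
  have h20 : 20 * ε₀ ^ 2 < r := by
    have h1 : 1 ≤ r := one_le_norm_xi0_div j
    nlinarith
  have hlo : 0 < r - 20 * ε₀ ^ 2 := by linarith
  have hhi : 0 < r + 20 * ε₀ ^ 2 := by positivity
  refine HasCompactSupport.intro (K := Icc (Real.log (r - 20 * ε₀ ^ 2)) (Real.log (r + 20 * ε₀ ^ 2)))
    isCompact_Icc fun x hx => ?_
  unfold etaProfile
  refine freqCutoff_eq_zero ?_
  rw [mem_Icc, not_and_or, not_le, not_le] at hx
  rcases hx with hx | hx
  · -- `eˣ < r - 20ε₀²`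
    have hex : Real.exp x < r - 20 * ε₀ ^ 2 := by
      calc Real.exp x < Real.exp (Real.log (r - 20 * ε₀ ^ 2)) := Real.exp_lt_exp.2 hx
        _ = r - 20 * ε₀ ^ 2 := Real.exp_log hlo
    have h : (Real.exp x - r) / (10 * ε₀ ^ 2) ≤ -2 := by
      rw [div_le_iff₀ hδ]
      linarith
    have h' : 2 ≤ -((Real.exp x - r) / (10 * ε₀ ^ 2)) := by linarith
    exact h'.trans (neg_le_abs _)
  · -- `r + 20ε₀² < eˣ`
    have hex : r + 20 * ε₀ ^ 2 < Real.exp x := by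
      calc r + 20 * ε₀ ^ 2 = Real.exp (Real.log (r + 20 * ε₀ ^ 2)) := (Real.exp_log hhi).symm
        _ < Real.exp x := Real.exp_lt_exp.2 hx
    have h : 2 ≤ (Real.exp x - r) / (10 * ε₀ ^ 2) := by
      rw [le_div_iff₀ hδ]
      linarith
    exact h.trans (le_abs_self _)

/-- The complexified profile `x ↦ (Fⱼ(x) : ℂ)` is smooth. [folklore] -/
theorem contDiff_etaProfile_ofReal (ε₀ : ℝ) (j : Fin 3) {n : ℕ∞} :
    ContDiff ℝ n fun x => ((etaProfile ε₀ j x : ℝ) : ℂ) :=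
  Complex.ofRealCLM.contDiff.comp (contDiff_etaProfile ε₀ j)

/-- The complexified profile is compactly supported. [folklore] -/
theorem hasCompactSupport_etaProfile_ofReal {ε₀ : ℝ} (hε : 0 < ε₀) (hε' : ε₀ ≤ 1 / 5) (j : Fin 3) :
    HasCompactSupport fun x => ((etaProfile ε₀ j x : ℝ) : ℂ) :=
  (hasCompactSupport_etaProfile hε hε' j).comp_left Complex.ofReal_zero

/-! ### Step 2: Fourier inversion — `Fⱼ = 𝓕⁻ϕⱼ` with `ϕⱼ = 𝓕Fⱼ` Schwartz -/

/-- The profile `Fⱼ` as a Schwartz function (smooth and compactly supported). [cite: Tao2016AveragedNS, §3.3 p. 16] -/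
def etaProfileS {ε₀ : ℝ} (hε : 0 < ε₀) (hε' : ε₀ ≤ 1 / 5) (j : Fin 3) : 𝓢(ℝ, ℂ) :=
  (hasCompactSupport_etaProfile_ofReal hε hε' j).toSchwartzMap (contDiff_etaProfile_ofReal ε₀ j)

/-- Values of the Schwartz profile. [folklore] -/
@[simp] theorem etaProfileS_apply {ε₀ : ℝ} (hε : 0 < ε₀) (hε' : ε₀ ≤ 1 / 5) (j : Fin 3) (x : ℝ) :
    etaProfileS hε hε' j x = ((etaProfile ε₀ j x : ℝ) : ℂ) := rfl

/-- **The rapidly decreasing weights `ϕⱼ = 𝓕Fⱼ`** (Schwartz, being Fourier transforms of Schwartz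
functions): "where `ϕ : ℝ² → ℂ` is a rapidly decreasing function", here `ϕ(s₂,s₃) = ϕ₁(s₂)ϕ₂(s₃)` in
the variables `tⱼ = 2πsⱼ`. [cite: Tao2016AveragedNS, §3.3 p. 16] -/
def etaPhi {ε₀ : ℝ} (hε : 0 < ε₀) (hε' : ε₀ ≤ 1 / 5) (j : Fin 3) : 𝓢(ℝ, ℂ) :=
  𝓕 (etaProfileS hε hε' j)

/-- **Fourier inversion for the profiles**: `∫ e^{2πisx} ϕⱼ(s) ds = Fⱼ(x)` for every `x`
("By Fourier inversion, we thus have a representation …", Tao p. 16). [cite: Tao2016AveragedNS, §3.3 p. 16] -/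
theorem integral_imagExp_mul_etaPhi {ε₀ : ℝ} (hε : 0 < ε₀) (hε' : ε₀ ≤ 1 / 5) (j : Fin 3) (x : ℝ) :
    ∫ s : ℝ, imagExp (2 * Real.pi) (s * x) * etaPhi hε hε' j s = ((etaProfile ε₀ j x : ℝ) : ℂ) := by
  have h : (𝓕⁻ (etaPhi hε hε' j) : 𝓢(ℝ, ℂ)) = etaProfileS hε hε' j :=
    fourierInv_fourier_eq (etaProfileS hε hε' j)
  have h2 : ((etaProfile ε₀ j x : ℝ) : ℂ) = 𝓕⁻ (⇑(etaPhi hε hε' j)) x := by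
    rw [← SchwartzMap.fourierInv_coe, h, etaProfileS_apply]
  rw [h2, Real.fourierInv_eq']
  refine integral_congr_ae (Eventually.of_forall fun s => ?_)
  simp only [imagExp, smul_eq_mul, Real.inner_apply]

/-- **All polynomial moments of a Schwartz function are finite**:
`∫ (1+|s|)ᵏ |ϕ(s)| ds < ∞` ("`∫∫ |ϕ(t₂,t₃)| (1+|t₂|+|t₃|)ᵏ dt₂dt₃ < ∞` for all `k ≥ 0`", Tao p. 16). [cite: Tao2016AveragedNS, §3.3 p. 16] -/
theorem integrable_one_add_abs_pow_mul (g : 𝓢(ℝ, ℂ)) (k : ℕ) :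
    Integrable (fun s : ℝ => (1 + |s|) ^ k * ‖g s‖) := by
  have h0 := g.integrable_pow_mul volume 0
  have hk := g.integrable_pow_mul volume k
  refine (((h0.add hk).const_mul (2 ^ k))).mono' ?_ (Eventually.of_forall fun s => ?_)
  · exact ((by fun_prop : Continuous fun s : ℝ => (1 + |s|) ^ k).mul
      g.continuous.norm).aestronglyMeasurable
  · simp only [pow_zero, one_mul, Real.norm_eq_abs, Pi.add_apply]
    rw [abs_of_nonneg (by positivity)]
    have hpow : (1 + |s|) ^ k ≤ 2 ^ k * (1 + |s| ^ k) := by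
      rcases le_or_gt |s| 1 with hs | hs
      · calc (1 + |s|) ^ k ≤ 2 ^ k := pow_le_pow_left₀ (by positivity) (by linarith) k
          _ ≤ 2 ^ k * (1 + |s| ^ k) := le_mul_of_one_le_right (by positivity) (by
              linarith [pow_nonneg (abs_nonneg s) k])
      · calc (1 + |s|) ^ k ≤ (2 * |s|) ^ k := pow_le_pow_left₀ (by positivity) (by linarith) k
          _ = 2 ^ k * |s| ^ k := mul_pow _ _ _
          _ ≤ 2 ^ k * (1 + |s| ^ k) := by gcongr; linarith
    calc (1 + |s|) ^ k * ‖g s‖ ≤ 2 ^ k * (1 + |s| ^ k) * ‖g s‖ := by gcongr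
      _ = 2 ^ k * (‖g s‖ + |s| ^ k * ‖g s‖) := by ring

/-! ### Step 3: the complex averaging datum on `Ω = ℝ²` -/

/-- The **Cauchy density** `((1+s₂²)(1+s₃²))⁻¹` making `ℝ²` a finite measure space (the complex
weight `ϕ` itself is absorbed into `m₁`, "using `m_{1,ω}(D)` to absorb scalar factors", §3.2 ¶1). [folklore] -/
def cauchyDensity (s : ℝ × ℝ) : ℝ≥0 :=
  ⟨(1 + s.1 ^ 2)⁻¹ * (1 + s.2 ^ 2)⁻¹, by positivity⟩

/-- The value of the Cauchy density. [folklore] -/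
theorem coe_cauchyDensity (s : ℝ × ℝ) :
    (cauchyDensity s : ℝ) = (1 + s.1 ^ 2)⁻¹ * (1 + s.2 ^ 2)⁻¹ := rfl

/-- The Cauchy density is continuous. [folklore] -/
theorem continuous_cauchyDensity : Continuous cauchyDensity := by
  have h1 : Continuous fun s : ℝ × ℝ => (1 + s.1 ^ 2)⁻¹ :=
    Continuous.inv₀ (by fun_prop) fun s => by positivity
  have h2 : Continuous fun s : ℝ × ℝ => (1 + s.2 ^ 2)⁻¹ :=
    Continuous.inv₀ (by fun_prop) fun s => by positivity
  exact Continuous.subtype_mk (h1.mul h2) _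

/-- The Cauchy density is measurable. [folklore] -/
theorem measurable_cauchyDensity : Measurable cauchyDensity :=
  continuous_cauchyDensity.measurable

/-- The density cancels the weight `(1+s₂²)(1+s₃²)`. [folklore] -/
theorem cauchyDensity_mul_weight (s : ℝ × ℝ) :
    (cauchyDensity s : ℝ) * ((1 + s.1 ^ 2) * (1 + s.2 ^ 2)) = 1 := by
  rw [coe_cauchyDensity]
  have h1 : (1 + s.1 ^ 2) ≠ 0 := by positivity
  have h2 : (1 + s.2 ^ 2) ≠ 0 := by positivity
  field_simp

/-- The Cauchy density is integrable (`∫ (1+s²)⁻¹ ds = π`). [folklore] -/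
theorem integrable_cauchyDensity : Integrable (fun s : ℝ × ℝ => (cauchyDensity s : ℝ)) := by
  have h := (integrable_inv_one_add_sq.mul_prod integrable_inv_one_add_sq)
  rw [← Measure.volume_eq_prod] at h
  exact h

/-- **The finite measure `dμ = ((1+s₂²)(1+s₃²))⁻¹ ds₂ds₃` on `Ω = ℝ²`.** [cite: Tao2016AveragedNS, §3.3 p. 16] -/
def betaDatumMeasure : Measure (ℝ × ℝ) :=
  volume.withDensity fun s => (cauchyDensity s : ℝ≥0∞)

/-- `μ` is finite. [folklore] -/
instance isFiniteMeasure_betaDatumMeasure : IsFiniteMeasure betaDatumMeasure := by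
  refine isFiniteMeasure_withDensity (ne_of_lt ?_)
  have h := integrable_cauchyDensity.hasFiniteIntegral
  rw [hasFiniteIntegral_iff_enorm] at h
  refine lt_of_le_of_lt (le_of_eq (lintegral_congr fun s => ?_)) h
  rw [Real.enorm_eq_ofReal (cauchyDensity s).coe_nonneg, ENNReal.ofReal_coe_nnreal]

variable {ε₀ : ℝ}

/-- The **complex weight absorbed into `m₁`**: `c(s) = ϕ₁(s₂) ϕ₂(s₃) (1+s₂²)(1+s₃²)` (so that
`c dμ = ϕ₁(s₂)ϕ₂(s₃) ds₂ds₃`). [cite: Tao2016AveragedNS, §3.3 p. 16] -/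
def betaCoef (hε : 0 < ε₀) (hε' : ε₀ ≤ 1 / 5) (s : ℝ × ℝ) : ℂ :=
  etaPhi hε hε' 1 s.1 * etaPhi hε hε' 2 s.2 * (((1 + s.1 ^ 2) * (1 + s.2 ^ 2) : ℝ) : ℂ)

/-- `c` is continuous. [folklore] -/
theorem continuous_betaCoef (hε : 0 < ε₀) (hε' : ε₀ ≤ 1 / 5) : Continuous (betaCoef hε hε') := by
  unfold betaCoef
  have h1 := (etaPhi hε hε' 1).continuous
  have h2 := (etaPhi hε hε' 2).continuous
  fun_prop

/-- `|c(s)| = |ϕ₁(s₂)| |ϕ₂(s₃)| (1+s₂²)(1+s₃²)`. [folklore] -/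
theorem norm_betaCoef (hε : 0 < ε₀) (hε' : ε₀ ≤ 1 / 5) (s : ℝ × ℝ) :
    ‖betaCoef hε hε' s‖ = ‖etaPhi hε hε' 1 s.1‖ * ‖etaPhi hε hε' 2 s.2‖ * ((1 + s.1 ^ 2) * (1 + s.2 ^ 2)) := by
  unfold betaCoef
  rw [norm_mul, norm_mul, Complex.norm_real, Real.norm_of_nonneg (by positivity)]

/-- The density times the weight: `d(s) c(s) = ϕ₁(s₂) ϕ₂(s₃)`. [folklore] -/
theorem cauchyDensity_mul_betaCoef (hε : 0 < ε₀) (hε' : ε₀ ≤ 1 / 5) (s : ℝ × ℝ) :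
    ((cauchyDensity s : ℝ) : ℂ) * betaCoef hε hε' s = etaPhi hε hε' 1 s.1 * etaPhi hε hε' 2 s.2 := by
  have h := cauchyDensity_mul_weight s
  unfold betaCoef
  calc ((cauchyDensity s : ℝ) : ℂ) * (etaPhi hε hε' 1 s.1 * etaPhi hε hε' 2 s.2 *
        (((1 + s.1 ^ 2) * (1 + s.2 ^ 2) : ℝ) : ℂ))
      = etaPhi hε hε' 1 s.1 * etaPhi hε hε' 2 s.2 *
          (((cauchyDensity s : ℝ) * ((1 + s.1 ^ 2) * (1 + s.2 ^ 2)) : ℝ) : ℂ) := by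
        push_cast
        ring
    _ = etaPhi hε hε' 1 s.1 * etaPhi hε hε' 2 s.2 := by rw [h]; push_cast; ring

/-- The density times `|c|`: `d(s) |c(s)| = |ϕ₁(s₂)| |ϕ₂(s₃)|`. [folklore] -/
theorem cauchyDensity_mul_norm_betaCoef (hε : 0 < ε₀) (hε' : ε₀ ≤ 1 / 5) (s : ℝ × ℝ) :
    (cauchyDensity s : ℝ) * ‖betaCoef hε hε' s‖ = ‖etaPhi hε hε' 1 s.1‖ * ‖etaPhi hε hε' 2 s.2‖ := by
  have h := cauchyDensity_mul_weight s
  rw [norm_betaCoef]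
  calc (cauchyDensity s : ℝ) * (‖etaPhi hε hε' 1 s.1‖ * ‖etaPhi hε hε' 2 s.2‖ * ((1 + s.1 ^ 2) * (1 + s.2 ^ 2)))
      = ‖etaPhi hε hε' 1 s.1‖ * ‖etaPhi hε hε' 2 s.2‖ *
          ((cauchyDensity s : ℝ) * ((1 + s.1 ^ 2) * (1 + s.2 ^ 2))) := by ring
    _ = _ := by rw [h, mul_one]

/-- **The three random symbols of the `B_η` datum**: `m₁ = c(s) |ξ|^{-2πi(s₂+s₃)}`,
`m₂ = |ξ|^{2πis₂}`, `m₃ = |ξ|^{2πis₃}` (Tao's `D^{-it₂-it₃}`, `D^{it₂}`, `D^{it₃}` with `tⱼ = 2πsⱼ` and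
the weight `ϕ` absorbed into `m₁`). [cite: Tao2016AveragedNS, §3.3 p. 16] -/
def betaSymbol (hε : 0 < ε₀) (hε' : ε₀ ≤ 1 / 5) (i : Fin 3) (s : ℝ × ℝ) (ξ : ℝ³) : ℂ :=
  if i = 0 then betaCoef hε hε' s * imagPow (-(2 * Real.pi * (s.1 + s.2))) ξ
  else if i = 1 then imagPow (2 * Real.pi * s.1) ξ else imagPow (2 * Real.pi * s.2) ξ

/-- `m₁ = c(s) |ξ|^{-2πi(s₂+s₃)}`. [cite: Tao2016AveragedNS, §3.3 p. 16] -/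
theorem betaSymbol_zero (hε : 0 < ε₀) (hε' : ε₀ ≤ 1 / 5) (s : ℝ × ℝ) :
    betaSymbol hε hε' 0 s = fun ξ => betaCoef hε hε' s * imagPow (-(2 * Real.pi * (s.1 + s.2))) ξ := by
  funext ξ
  simp [betaSymbol]

/-- `m₂ = |ξ|^{2πis₂}`. [cite: Tao2016AveragedNS, §3.3 p. 16] -/
theorem betaSymbol_one (hε : 0 < ε₀) (hε' : ε₀ ≤ 1 / 5) (s : ℝ × ℝ) :
    betaSymbol hε hε' 1 s = imagPow (2 * Real.pi * s.1) := by
  funext ξ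
  simp [betaSymbol]

/-- `m₃ = |ξ|^{2πis₃}`. [cite: Tao2016AveragedNS, §3.3 p. 16] -/
theorem betaSymbol_two (hε : 0 < ε₀) (hε' : ε₀ ≤ 1 / 5) (s : ℝ × ℝ) :
    betaSymbol hε hε' 2 s = imagPow (2 * Real.pi * s.2) := by
  funext ξ
  simp [betaSymbol, show (2 : Fin 3) ≠ 0 by decide, show (2 : Fin 3) ≠ 1 by decide]

/-- Each `m_{i,s}` is a complex Fourier multiplier of order `0`. [cite: Tao2016AveragedNS, §3.3 p. 16] -/
theorem isComplexSymbol_betaSymbol (hε : 0 < ε₀) (hε' : ε₀ ≤ 1 / 5) (i : Fin 3) (s : ℝ × ℝ) :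
    IsComplexSymbol (betaSymbol hε hε' i s) := by
  fin_cases i
  · simp only [Fin.zero_eta, betaSymbol_zero]
    exact (isComplexSymbol_imagPow _).const_mul _
  · simp only [Fin.mk_one, betaSymbol_one]
    exact isComplexSymbol_imagPow _
  · simp only [Fin.reduceFinMk, betaSymbol_two]
    exact isComplexSymbol_imagPow _

/-- `s ↦ m_{i,s}(ξ)` is measurable. [folklore] -/
theorem measurable_betaSymbol (hε : 0 < ε₀) (hε' : ε₀ ≤ 1 / 5) (i : Fin 3) (ξ : ℝ³) :
    Measurable fun s : ℝ × ℝ => betaSymbol hε hε' i s ξ := by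
  have hc := (continuous_betaCoef hε hε').measurable
  fin_cases i
  · simp only [Fin.zero_eta, betaSymbol_zero]
    exact hc.mul ((measurable_imagPow_left ξ).comp (by fun_prop))
  · simp only [Fin.mk_one, betaSymbol_one]
    exact (measurable_imagPow_left ξ).comp (by fun_prop)
  · simp only [Fin.reduceFinMk, betaSymbol_two]
    exact (measurable_imagPow_left ξ).comp (by fun_prop)

/-- A polynomial majorant for the product of the three seminorms, as a function of `s`. [folklore] -/
def betaMomentBound (k₁ k₂ k₃ : ℕ) (s : ℝ × ℝ) : ℝ :=
  imagPowConst k₁ * (1 + |2 * Real.pi * (s.1 + s.2)|) ^ k₁ *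
    (imagPowConst k₂ * (1 + |2 * Real.pi * s.1|) ^ k₂) * (imagPowConst k₃ * (1 + |2 * Real.pi * s.2|) ^ k₃)

/-- The majorant is nonnegative. [folklore] -/
theorem betaMomentBound_nonneg (k₁ k₂ k₃ : ℕ) (s : ℝ × ℝ) : 0 ≤ betaMomentBound k₁ k₂ k₃ s := by
  unfold betaMomentBound
  have := imagPowConst_nonneg k₁
  have := imagPowConst_nonneg k₂
  have := imagPowConst_nonneg k₃
  positivity

/-- The majorant is continuous. [folklore] -/
theorem continuous_betaMomentBound (k₁ k₂ k₃ : ℕ) : Continuous (betaMomentBound k₁ k₂ k₃) := by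
  unfold betaMomentBound
  fun_prop

/-- `1 + |2πa| ≤ 2π (1+|a|)`. [folklore] -/
theorem one_add_abs_two_pi_mul_le (a : ℝ) : 1 + |2 * Real.pi * a| ≤ 2 * Real.pi * (1 + |a|) := by
  rw [abs_mul, abs_of_pos Real.two_pi_pos]
  have : (1 : ℝ) ≤ 2 * Real.pi := by linarith [Real.two_le_pi]
  nlinarith [abs_nonneg a]

/-- **The majorant splits**: `P(s) ≤ C (1+|s₂|)^{k₁+k₂} (1+|s₃|)^{k₁+k₃}`. [folklore] -/
theorem betaMomentBound_le (k₁ k₂ k₃ : ℕ) (s : ℝ × ℝ) :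
    betaMomentBound k₁ k₂ k₃ s ≤
      (imagPowConst k₁ * imagPowConst k₂ * imagPowConst k₃ * (2 * Real.pi) ^ (k₁ + k₂ + k₃)) *
        ((1 + |s.1|) ^ (k₁ + k₂) * (1 + |s.2|) ^ (k₁ + k₃)) := by
  have hA₁ := imagPowConst_nonneg k₁
  have hA₂ := imagPowConst_nonneg k₂
  have hA₃ := imagPowConst_nonneg k₃
  have h2π : 0 < 2 * Real.pi := Real.two_pi_pos
  have e₁ : 1 + |2 * Real.pi * (s.1 + s.2)| ≤ 2 * Real.pi * ((1 + |s.1|) * (1 + |s.2|)) := by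
    refine (one_add_abs_two_pi_mul_le _).trans ?_
    gcongr
    nlinarith [abs_add_le s.1 s.2, abs_nonneg s.1, abs_nonneg s.2]
  have e₂ := one_add_abs_two_pi_mul_le s.1
  have e₃ := one_add_abs_two_pi_mul_le s.2
  have p₁ : (1 + |2 * Real.pi * (s.1 + s.2)|) ^ k₁ ≤ (2 * Real.pi) ^ k₁ * ((1 + |s.1|) ^ k₁ * (1 + |s.2|) ^ k₁) := by
    calc _ ≤ (2 * Real.pi * ((1 + |s.1|) * (1 + |s.2|))) ^ k₁ := pow_le_pow_left₀ (by positivity) e₁ k₁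
      _ = _ := by rw [mul_pow (2 * Real.pi), mul_pow (1 + |s.1|)]
  have p₂ : (1 + |2 * Real.pi * s.1|) ^ k₂ ≤ (2 * Real.pi) ^ k₂ * (1 + |s.1|) ^ k₂ := by
    calc _ ≤ (2 * Real.pi * (1 + |s.1|)) ^ k₂ := pow_le_pow_left₀ (by positivity) e₂ k₂
      _ = _ := by rw [mul_pow]
  have p₃ : (1 + |2 * Real.pi * s.2|) ^ k₃ ≤ (2 * Real.pi) ^ k₃ * (1 + |s.2|) ^ k₃ := by
    calc _ ≤ (2 * Real.pi * (1 + |s.2|)) ^ k₃ := pow_le_pow_left₀ (by positivity) e₃ k₃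
      _ = _ := by rw [mul_pow]
  unfold betaMomentBound
  calc imagPowConst k₁ * (1 + |2 * Real.pi * (s.1 + s.2)|) ^ k₁ *
        (imagPowConst k₂ * (1 + |2 * Real.pi * s.1|) ^ k₂) * (imagPowConst k₃ * (1 + |2 * Real.pi * s.2|) ^ k₃)
      ≤ imagPowConst k₁ * ((2 * Real.pi) ^ k₁ * ((1 + |s.1|) ^ k₁ * (1 + |s.2|) ^ k₁)) *
        (imagPowConst k₂ * ((2 * Real.pi) ^ k₂ * (1 + |s.1|) ^ k₂)) *
          (imagPowConst k₃ * ((2 * Real.pi) ^ k₃ * (1 + |s.2|) ^ k₃)) := by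
        gcongr
    _ = _ := by rw [pow_add, pow_add, pow_add, pow_add]; ring

/-- **The integrability conditions (3.5) for the `B_η` datum**: for all `k₁ k₂ k₃`,
`∫ ‖m₁‖_{k₁} ‖m₂‖_{k₂} ‖m₃‖_{k₃} dμ < ∞`, from `‖D^{it}‖_k ≤ A_k (1+|t|)ᵏ` and the finiteness of all
moments of `ϕⱼ`. [cite: Tao2016AveragedNS, §3.3 p. 16 and (3.5)] -/
theorem betaMoment_lt_top (hε : 0 < ε₀) (hε' : ε₀ ≤ 1 / 5) (k₁ k₂ k₃ : ℕ) :
    ∫⁻ s, symbolSeminorm k₁ (betaSymbol hε hε' 0 s) * symbolSeminorm k₂ (betaSymbol hε hε' 1 s) *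
        symbolSeminorm k₃ (betaSymbol hε hε' 2 s) ∂betaDatumMeasure < ∞ := by
  -- pointwise polynomial bound
  have hpt : ∀ s : ℝ × ℝ,
      symbolSeminorm k₁ (betaSymbol hε hε' 0 s) * symbolSeminorm k₂ (betaSymbol hε hε' 1 s) *
          symbolSeminorm k₃ (betaSymbol hε hε' 2 s) ≤
        ENNReal.ofReal (‖betaCoef hε hε' s‖ * betaMomentBound k₁ k₂ k₃ s) := by
    intro s
    have hA₁ := imagPowConst_nonneg k₁
    have hA₂ := imagPowConst_nonneg k₂
    have hA₃ := imagPowConst_nonneg k₃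
    have h0 : symbolSeminorm k₁ (betaSymbol hε hε' 0 s) ≤
        ENNReal.ofReal (‖betaCoef hε hε' s‖ * (imagPowConst k₁ * (1 + |2 * Real.pi * (s.1 + s.2)|) ^ k₁)) := by
      rw [betaSymbol_zero]
      refine (symbolSeminorm_const_mul_le (contDiffOn_imagPow _) _ k₁).trans ?_
      rw [ENNReal.ofReal_mul (norm_nonneg _), ofReal_norm]
      gcongr
      refine (symbolSeminorm_imagPow_le k₁ _).trans (le_of_eq ?_)
      rw [abs_neg]
    have h1 : symbolSeminorm k₂ (betaSymbol hε hε' 1 s) ≤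
        ENNReal.ofReal (imagPowConst k₂ * (1 + |2 * Real.pi * s.1|) ^ k₂) := by
      rw [betaSymbol_one]
      exact symbolSeminorm_imagPow_le k₂ _
    have h2 : symbolSeminorm k₃ (betaSymbol hε hε' 2 s) ≤
        ENNReal.ofReal (imagPowConst k₃ * (1 + |2 * Real.pi * s.2|) ^ k₃) := by
      rw [betaSymbol_two]
      exact symbolSeminorm_imagPow_le k₃ _
    calc _ ≤ ENNReal.ofReal (‖betaCoef hε hε' s‖ * (imagPowConst k₁ * (1 + |2 * Real.pi * (s.1 + s.2)|) ^ k₁)) *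
          ENNReal.ofReal (imagPowConst k₂ * (1 + |2 * Real.pi * s.1|) ^ k₂) *
            ENNReal.ofReal (imagPowConst k₃ * (1 + |2 * Real.pi * s.2|) ^ k₃) :=
          mul_le_mul' (mul_le_mul' h0 h1) h2
      _ = ENNReal.ofReal (‖betaCoef hε hε' s‖ * betaMomentBound k₁ k₂ k₃ s) := by
          rw [← ENNReal.ofReal_mul (by positivity), ← ENNReal.ofReal_mul (by positivity)]
          unfold betaMomentBound
          ring_nf
  -- integrate against the density
  refine lt_of_le_of_lt (lintegral_mono hpt) ?_
  have hmeas : AEMeasurable (fun s : ℝ × ℝ => ENNReal.ofReal (‖betaCoef hε hε' s‖ * betaMomentBound k₁ k₂ k₃ s))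
      volume :=
    (ENNReal.measurable_ofReal.comp (((continuous_betaCoef hε hε').norm.mul
      (continuous_betaMomentBound k₁ k₂ k₃)).measurable)).aemeasurable
  rw [betaDatumMeasure, lintegral_withDensity_eq_lintegral_mul₀ measurable_cauchyDensity.coe_nnreal_ennreal.aemeasurable
    hmeas]
  -- the real integrand `d(s) |c(s)| P(s) ≤ C (1+|s₂|)^a |ϕ₁(s₂)| (1+|s₃|)^b |ϕ₂(s₃)|` is integrable
  set C : ℝ := imagPowConst k₁ * imagPowConst k₂ * imagPowConst k₃ * (2 * Real.pi) ^ (k₁ + k₂ + k₃) with hC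
  have hC0 : 0 ≤ C := by
    have := imagPowConst_nonneg k₁
    have := imagPowConst_nonneg k₂
    have := imagPowConst_nonneg k₃
    positivity
  have hint : Integrable (fun s : ℝ × ℝ => (cauchyDensity s : ℝ) * (‖betaCoef hε hε' s‖ * betaMomentBound k₁ k₂ k₃ s)) := by
    have hprod : Integrable (fun s : ℝ × ℝ =>
        C * (((1 + |s.1|) ^ (k₁ + k₂) * ‖etaPhi hε hε' 1 s.1‖) * ((1 + |s.2|) ^ (k₁ + k₃) * ‖etaPhi hε hε' 2 s.2‖))) := by
      have h := ((integrable_one_add_abs_pow_mul (etaPhi hε hε' 1) (k₁ + k₂)).mul_prod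
        (integrable_one_add_abs_pow_mul (etaPhi hε hε' 2) (k₁ + k₃))).const_mul C
      rw [← Measure.volume_eq_prod] at h
      exact h
    refine hprod.mono' ?_ (Eventually.of_forall fun s => ?_)
    · exact ((NNReal.continuous_coe.comp continuous_cauchyDensity).mul
        ((continuous_betaCoef hε hε').norm.mul (continuous_betaMomentBound k₁ k₂ k₃))).aestronglyMeasurable
    · rw [Real.norm_of_nonneg (mul_nonneg (cauchyDensity s).coe_nonneg
        (mul_nonneg (norm_nonneg _) (betaMomentBound_nonneg _ _ _ _))), ← mul_assoc,
        cauchyDensity_mul_norm_betaCoef]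
      calc ‖etaPhi hε hε' 1 s.1‖ * ‖etaPhi hε hε' 2 s.2‖ * betaMomentBound k₁ k₂ k₃ s
          ≤ ‖etaPhi hε hε' 1 s.1‖ * ‖etaPhi hε hε' 2 s.2‖ *
              (C * ((1 + |s.1|) ^ (k₁ + k₂) * (1 + |s.2|) ^ (k₁ + k₃))) := by
            gcongr
            exact betaMomentBound_le k₁ k₂ k₃ s
        _ = _ := by ring
  refine lt_of_le_of_lt (le_of_eq (lintegral_congr fun s => ?_)) hint.lintegral_lt_top
  simp only [Pi.mul_apply]
  rw [ENNReal.ofReal_mul (cauchyDensity s).coe_nonneg, ENNReal.ofReal_coe_nnreal]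

/-- **The complex averaging datum of §3.3 representing `B_η` as a complex average of `B`**:
`Ω = ℝ²` with `dμ = ((1+s₂²)(1+s₃²))⁻¹ ds`, symbols `m₁ = c(s)|ξ|^{-2πi(s₂+s₃)}`, `m₂ = |ξ|^{2πis₂}`,
`m₃ = |ξ|^{2πis₃}`, no rotations (`R = id`), no dilations (`λ = 1`) — Tao's
`B_η = ∫∫ ⟨B(D^{-it₂-it₃}u, D^{it₂}v), D^{it₃}w⟩ ϕ(t₂,t₃) dt₂dt₃`. [cite: Tao2016AveragedNS, §3.3 p. 16] -/
def betaDatum (hε : 0 < ε₀) (hε' : ε₀ ≤ 1 / 5) : ComplexAveragingDatum where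
  Ω := ℝ × ℝ
  μ := betaDatumMeasure
  m := betaSymbol hε hε'
  R _ _ := LinearIsometryEquiv.refl ℝ _
  lam _ _ := 1
  isComplexSymbol := isComplexSymbol_betaSymbol hε hε'
  det_R _ _ := LinearMap.det_id
  lam_pos _ _ := one_pos
  lam_bdd := ⟨1, fun _ _ => by norm_num⟩
  moment := betaMoment_lt_top hε hε'
  measurable_m i ξ _ := measurable_betaSymbol hε hε' i ξ
  measurable_R _ _ := measurable_const
  measurable_lam _ := measurable_const

/-! ### Step 4: the symbol of the average — `\widehat{m(D)u} = m û`, Fubini, inversion -/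

/-- The slots of the `B_η` datum are the multipliers `m_{i,s}(D)` (no rotation, no dilation). [cite: Tao2016AveragedNS, §3.3 p. 16] -/
theorem betaDatum_slot (hε : 0 < ε₀) (hε' : ε₀ ≤ 1 / 5) (i : Fin 3) (s : ℝ × ℝ) (u : L2C) :
    (betaDatum hε hε').slot i s u =
      fourierMultiplier ((isComplexSymbol_betaSymbol hε hε' i s).memLp_top.toLp (betaSymbol hε hε' i s)) u := by
  unfold ComplexAveragingDatum.slot ComplexAveragingDatum.symbolLp
  rw [show (betaDatum hε hε').lam i s = 1 from rfl, dil_one,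
    show (betaDatum hε hε').R i s = LinearIsometryEquiv.refl ℝ _ from rfl, rot_refl]
  rfl

/-- `\widehat{m_{i,s}(D) u} = m_{i,s} û` a.e. [cite: Tao2016AveragedNS, §1.1 p. 6] -/
theorem fourierFn_betaDatum_slot (hε : 0 < ε₀) (hε' : ε₀ ≤ 1 / 5) (i : Fin 3) (s : ℝ × ℝ) (u : L2C) :
    fourierFn ((betaDatum hε hε').slot i s u) =ᵐ[volume] fun ξ => betaSymbol hε hε' i s ξ • fourierFn u ξ := by
  rw [betaDatum_slot]
  exact fourierFn_fourierMultiplier_toLp _ u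

/-- `Λ` is homogeneous in its second vector argument. [cite: Tao2016AveragedNS, (1.4)] -/
theorem Λ_smul₂ (ξ₁ ξ₂ : ℝ³) (c : ℂ) (X₁ X₂ X₃ : ℂ³) :
    Λ ξ₁ ξ₂ X₁ (c • X₂) X₃ = c * Λ ξ₁ ξ₂ X₁ X₂ X₃ := by
  simp only [Λ, cdot, PiLp.smul_apply, smul_eq_mul, Fin.sum_univ_three]
  ring

/-- `Λ` is homogeneous in its third vector argument. [cite: Tao2016AveragedNS, (1.4)] -/
theorem Λ_smul₃ (ξ₁ ξ₂ : ℝ³) (c : ℂ) (X₁ X₂ X₃ : ℂ³) :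
    Λ ξ₁ ξ₂ X₁ X₂ (c • X₃) = c * Λ ξ₁ ξ₂ X₁ X₂ X₃ := by
  simp only [Λ, cdot, PiLp.smul_apply, smul_eq_mul, Fin.sum_univ_three]
  ring

/-- The **product of the three symbols on the frequency hyperplane**,
`Φ(s; ξ₁,ξ₂) = m₁(ξ₁) m₂(ξ₂) m₃(ξ₃)`, `ξ₃ = -ξ₁-ξ₂`. [cite: Tao2016AveragedNS, §3.3 p. 16] -/
def betaPhase (hε : 0 < ε₀) (hε' : ε₀ ≤ 1 / 5) (s : ℝ × ℝ) (p : ℝ³ × ℝ³) : ℂ :=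
  betaSymbol hε hε' 0 s p.1 * betaSymbol hε hε' 1 s p.2 * betaSymbol hε hε' 2 s (-p.1 - p.2)

/-- **The phase identity**: `m₁(ξ₁)m₂(ξ₂)m₃(ξ₃) = c(s) e^{2πis₂(log|ξ₂| - log|ξ₁|)} e^{2πis₃(log|ξ₃| - log|ξ₁|)}`
(Tao: `N₁^{-it₂-it₃} N₂^{it₂} N₃^{it₃} = e^{it₂ log(N₂/N₁)} e^{it₃ log(N₃/N₁)}`). [cite: Tao2016AveragedNS, §3.3 p. 16] -/
theorem betaPhase_eq (hε : 0 < ε₀) (hε' : ε₀ ≤ 1 / 5) (s : ℝ × ℝ) (p : ℝ³ × ℝ³) :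
    betaPhase hε hε' s p = betaCoef hε hε' s *
      (imagExp (2 * Real.pi) (s.1 * (Real.log ‖p.2‖ - Real.log ‖p.1‖)) *
        imagExp (2 * Real.pi) (s.2 * (Real.log ‖-p.1 - p.2‖ - Real.log ‖p.1‖))) := by
  unfold betaPhase
  rw [betaSymbol_zero, betaSymbol_one, betaSymbol_two]
  simp only [imagPow, imagExp, mul_assoc]
  rw [← Complex.exp_add, ← Complex.exp_add, ← Complex.exp_add]
  congr 2
  push_cast
  ring

/-- `|Φ(s; ·)| = |c(s)|`. [folklore] -/
theorem norm_betaPhase (hε : 0 < ε₀) (hε' : ε₀ ≤ 1 / 5) (s : ℝ × ℝ) (p : ℝ³ × ℝ³) :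
    ‖betaPhase hε hε' s p‖ = ‖betaCoef hε hε' s‖ := by
  unfold betaPhase
  rw [betaSymbol_zero, betaSymbol_one, betaSymbol_two]
  simp only [norm_mul, norm_imagPow, mul_one]

/-- `Φ` is jointly measurable in `(s, ξ₁, ξ₂)`. [folklore] -/
theorem measurable_betaPhase (hε : 0 < ε₀) (hε' : ε₀ ≤ 1 / 5) :
    Measurable fun q : (ℝ × ℝ) × (ℝ³ × ℝ³) => betaPhase hε hε' q.1 q.2 := by
  unfold betaPhase
  simp only [betaSymbol_zero, betaSymbol_one, betaSymbol_two]
  have hc : Measurable fun q : (ℝ × ℝ) × (ℝ³ × ℝ³) => betaCoef hε hε' q.1 :=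
    (continuous_betaCoef hε hε').measurable.comp measurable_fst
  have h0 : Measurable fun q : (ℝ × ℝ) × (ℝ³ × ℝ³) => imagPow (-(2 * Real.pi * (q.1.1 + q.1.2))) q.2.1 :=
    measurable_imagPow.comp ((by fun_prop : Measurable fun q : (ℝ × ℝ) × (ℝ³ × ℝ³) =>
      -(2 * Real.pi * (q.1.1 + q.1.2))).prodMk (measurable_snd.fst))
  have h1 : Measurable fun q : (ℝ × ℝ) × (ℝ³ × ℝ³) => imagPow (2 * Real.pi * q.1.1) q.2.2 :=
    measurable_imagPow.comp ((by fun_prop : Measurable fun q : (ℝ × ℝ) × (ℝ³ × ℝ³) =>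
      2 * Real.pi * q.1.1).prodMk measurable_snd.snd)
  have h2 : Measurable fun q : (ℝ × ℝ) × (ℝ³ × ℝ³) => imagPow (2 * Real.pi * q.1.2) (-q.2.1 - q.2.2) :=
    measurable_imagPow.comp ((by fun_prop : Measurable fun q : (ℝ × ℝ) × (ℝ³ × ℝ³) =>
      2 * Real.pi * q.1.2).prodMk (measurable_snd.fst.neg.sub measurable_snd.snd))
  exact ((hc.mul h0).mul h1).mul h2

/-- **`⟨B(m₁(D)u, m₂(D)v), m₃(D)w⟩ = -πi ∫ Φ(s;ξ₁,ξ₂) Λ(û(ξ₁), v̂(ξ₂), ŵ(ξ₃))`** by `\widehat{m(D)u} = m û`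
and the trilinearity of `Λ` ((1.3) for the slots). [cite: Tao2016AveragedNS, (1.3) and §3.3 p. 16] -/
theorem eulerForm_betaDatum_slot (hε : 0 < ε₀) (hε' : ε₀ ≤ 1 / 5) (s : ℝ × ℝ) (u v w : L2C) :
    eulerForm ((betaDatum hε hε').slot 0 s u) ((betaDatum hε hε').slot 1 s v) ((betaDatum hε hε').slot 2 s w) =
      -(Real.pi * Complex.I) * ∫ p, betaPhase hε hε' s p * eulerIntegrand u v w p := by
  rw [eulerForm_eq_integral]
  congr 1
  refine integral_congr_ae ?_
  filter_upwards [ae_prod_of_ae₁ (fourierFn_betaDatum_slot hε hε' 0 s u),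
    ae_prod_of_ae₂ (fourierFn_betaDatum_slot hε hε' 1 s v),
    ae_prod_of_ae₃ (fourierFn_betaDatum_slot hε hε' 2 s w)] with p h1 h2 h3
  simp only [eulerIntegrand, h1, h2, h3, Λ_smul₁, Λ_smul₂, Λ_smul₃, betaPhase]
  ring

/-- `c` is integrable against `μ` (`∫ |c| dμ = ∫∫ |ϕ₁||ϕ₂| < ∞`). [folklore] -/
theorem integrable_betaCoef (hε : 0 < ε₀) (hε' : ε₀ ≤ 1 / 5) : Integrable (betaCoef hε hε') betaDatumMeasure := by
  rw [betaDatumMeasure, integrable_withDensity_iff_integrable_smul measurable_cauchyDensity]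
  have h : Integrable (fun s : ℝ × ℝ => etaPhi hε hε' 1 s.1 * etaPhi hε hε' 2 s.2) := by
    have h := ((etaPhi hε hε' 1).integrable (μ := volume)).mul_prod
      ((etaPhi hε hε' 2).integrable (μ := volume))
    rw [← Measure.volume_eq_prod] at h
    exact h
  refine h.congr (Eventually.of_forall fun s => ?_)
  show etaPhi hε hε' 1 s.1 * etaPhi hε hε' 2 s.2 = cauchyDensity s • betaCoef hε hε' s
  rw [NNReal.smul_def, Complex.real_smul, cauchyDensity_mul_betaCoef]

/-- Almost every frequency is non-zero. [folklore] -/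
theorem ae_freq_ne_zero : ∀ᵐ ξ : ℝ³ ∂volume, ξ ≠ 0 :=
  compl_mem_ae_iff.mpr (measure_singleton _)

/-- **Fubini integrability**: `(s, ξ₁, ξ₂) ↦ Φ(s;ξ₁,ξ₂) Λ(û(ξ₁), v̂(ξ₂), ŵ(ξ₃))` is integrable on
`Ω × ℝ³ × ℝ³` for `u, v ∈ H¹⁰`, `w ∈ L²` (`|Φ| = |c(s)|` integrable, (1.3) absolutely convergent —
"working first with Schwartz `u,v,w` to justify all the exchange of integrals, and then taking
limits" is replaced by the `H¹⁰` bound `integrable_Λ_fourierFn`). [cite: Tao2016AveragedNS, §3.3 p. 16] -/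
theorem integrable_betaPhase_mul (hε : 0 < ε₀) (hε' : ε₀ ≤ 1 / 5) {u v : L2C} (w : L2C)
    (hu : FunctionSpaces.eFourierSobolevNorm 10 u < ∞) (hv : FunctionSpaces.eFourierSobolevNorm 10 v < ∞) :
    Integrable (Function.uncurry fun (s : ℝ × ℝ) (p : ℝ³ × ℝ³) =>
      betaPhase hε hε' s p * eulerIntegrand u v w p) (betaDatumMeasure.prod volume) := by
  have hE : Integrable (eulerIntegrand u v w) volume := integrable_Λ_fourierFn w hu hv
  have hg : Integrable (fun q : (ℝ × ℝ) × (ℝ³ × ℝ³) => ‖betaCoef hε hε' q.1‖ * ‖eulerIntegrand u v w q.2‖)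
      (betaDatumMeasure.prod volume) :=
    (integrable_betaCoef hε hε').norm.mul_prod hE.norm
  refine hg.mono' ?_ (Eventually.of_forall fun q => ?_)
  · exact ((measurable_betaPhase hε hε').aestronglyMeasurable).mul hE.1.comp_snd
  · obtain ⟨s, p⟩ := q
    rw [Function.uncurry_apply_pair, norm_mul, norm_betaPhase]

/-- **The `s`-integral of the phase is the comparability weight**: for `ξ₁, ξ₂, ξ₃ ≠ 0`,
`∫_Ω Φ(s;ξ₁,ξ₂) dμ(s) = ∫∫ ϕ₁(s₂)ϕ₂(s₃) e^{2πis₂ log(|ξ₂|/|ξ₁|)} e^{2πis₃ log(|ξ₃|/|ξ₁|)} ds = F₁ F₂ = η(|ξ₁|,|ξ₂|,|ξ₃|)`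
(Fourier inversion, step 2). [cite: Tao2016AveragedNS, §3.3 p. 16] -/
theorem integral_betaPhase (hε : 0 < ε₀) (hε' : ε₀ ≤ 1 / 5) {p : ℝ³ × ℝ³} (h₁ : p.1 ≠ 0) (h₂ : p.2 ≠ 0)
    (h₃ : -p.1 - p.2 ≠ 0) :
    ∫ s, betaPhase hε hε' s p ∂betaDatumMeasure = ((eta ε₀ ‖p.1‖ ‖p.2‖ ‖-p.1 - p.2‖ : ℝ) : ℂ) := by
  rw [betaDatumMeasure, integral_withDensity_eq_integral_smul measurable_cauchyDensity]
  have hpt : ∀ s : ℝ × ℝ, cauchyDensity s • betaPhase hε hε' s p =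
      (imagExp (2 * Real.pi) (s.1 * (Real.log ‖p.2‖ - Real.log ‖p.1‖)) * etaPhi hε hε' 1 s.1) *
        (imagExp (2 * Real.pi) (s.2 * (Real.log ‖-p.1 - p.2‖ - Real.log ‖p.1‖)) * etaPhi hε hε' 2 s.2) := by
    intro s
    rw [NNReal.smul_def, Complex.real_smul, betaPhase_eq, ← mul_assoc, cauchyDensity_mul_betaCoef]
    ring
  simp_rw [hpt]
  have hprod := integral_prod_mul (μ := (volume : Measure ℝ)) (ν := (volume : Measure ℝ))
    (fun a : ℝ => imagExp (2 * Real.pi) (a * (Real.log ‖p.2‖ - Real.log ‖p.1‖)) * etaPhi hε hε' 1 a)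
    (fun b : ℝ => imagExp (2 * Real.pi) (b * (Real.log ‖-p.1 - p.2‖ - Real.log ‖p.1‖)) * etaPhi hε hε' 2 b)
  rw [Measure.volume_eq_prod, hprod, integral_imagExp_mul_etaPhi, integral_imagExp_mul_etaPhi,
    eta_eq_etaProfile ε₀ (norm_pos_iff.2 h₁) (norm_pos_iff.2 h₂) (norm_pos_iff.2 h₃)]
  push_cast
  ring

/-- **The symbol of the `B_η` datum** (Tao p. 16: "From (1.3) and Fubini's theorem … we see that
`⟨B_η(u,v), w⟩ = -πi ∫_{ξ₁+ξ₂+ξ₃=0} η(|ξ₁|,|ξ₂|,|ξ₃|) Λ_{ξ₁,ξ₂,ξ₃}(û(ξ₁), v̂(ξ₂), ŵ(ξ₃))`"): for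
`u, v ∈ H¹⁰`, `w ∈ L²`, the complex average of `B` over `betaDatum` is `betaForm`. [cite: Tao2016AveragedNS, §3.3 p. 16] -/
theorem betaDatum_average_eulerForm (hε : 0 < ε₀) (hε' : ε₀ ≤ 1 / 5) {u v : L2C} (w : L2C)
    (hu : FunctionSpaces.eFourierSobolevNorm 10 u < ∞) (hv : FunctionSpaces.eFourierSobolevNorm 10 v < ∞) :
    (betaDatum hε hε').average eulerForm u v w = betaForm ε₀ u v w := by
  change ∫ s, eulerForm ((betaDatum hε hε').slot 0 s u) ((betaDatum hε hε').slot 1 s v)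
      ((betaDatum hε hε').slot 2 s w) ∂betaDatumMeasure = betaForm ε₀ u v w
  simp_rw [eulerForm_betaDatum_slot]
  rw [integral_const_mul]
  unfold betaForm
  congr 1
  rw [integral_integral_swap (integrable_betaPhase_mul hε hε' w hu hv)]
  refine integral_congr_ae ?_
  filter_upwards [ae_prod_of_ae₁ ae_freq_ne_zero, ae_prod_of_ae₂ ae_freq_ne_zero, ae_prod_of_ae₃ ae_freq_ne_zero]
    with p h₁ h₂ h₃
  rw [integral_mul_const, integral_betaPhase hε hε' h₁ h₂ h₃]
  rfl

/-! ### The discharge -/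

/-- **Tao 2016, §3.3: `B_η` is a complex average of `B`** — discharge of the named fact
`betaForm_isComplexAverage` with threshold `ε₁ = 1/5`: the datum `betaDatum` (imaginary-order
multipliers `D^{it}` weighted by the Fourier transform of `(x,y) ↦ η(1,eˣ,eʸ)`) reproduces
`⟨B_η(u,v), w⟩ = -πi ∫ η(|ξ₁|,|ξ₂|,|ξ₃|) Λ(û(ξ₁), v̂(ξ₂), ŵ(ξ₃))` for all `u, v, w ∈ H¹⁰_df ⊗ ℂ`. [cite: Tao2016AveragedNS, §3.3 p. 16] -/
theorem betaForm_isComplexAverage_holds : betaForm_isComplexAverage :=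
  ⟨1 / 5, by norm_num, fun _ hε hε' => ⟨betaDatum hε hε', fun u v w hu hv _ =>
    (betaDatum_average_eulerForm hε hε' w hu.1 hv.1).symm⟩⟩

end Literature.Analysis.FluidPDE.Tao2016
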